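import Summits.ABC.ABC.Theses.IneffectiveSubspace
import Summits.ABC.ABC.Theorems.IneffectiveSubspaceUniformSadicTowerFourNormalForm
import Summits.ABC.ABC.Theorems.IneffectiveSubspaceUniformSadicTowerFourQuarticRootWall
import Summits.ABC.ABC.Theorems.IneffectiveSubspaceDeepRegimeABCRoughPowerfulTail
import Summits.ABC.ABC.Theorems.IneffectiveSubspaceDeepRegimeABCOmegaTail

/-!
# Crux `DeepRegimeABC` (stmt-ABC-15121) — crux-strategist s1: the typed STEEP / DIFFUSE split
# (what the route's mechanism crux #2 `UniformSadicTowerFour` pays on crux #6), kernel-checked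

Companion to `Cruxes/DeepRegimeABC/STRATEGY-CENSUS.md` (§Decomposition D2, §Negation N0).
Everything here is sorry-free; nothing here is an engine.  Purpose: to TYPE the one decomposition of
the crux that the route header ("NOT DECOMPOSED YET … for #6 the STEEP/FLAT split as items") and
`BarrierNotes-r2-k5.md` (closing "planners' options") name as the remaining planner move, prove its
glue, prove it LOSSLESS, and so pin down exactly what crux #6 costs beyond crux #2 and Ridout:

* `DiffuseDeepTailABC` — abc with exponent `1+ε` on the deep tail `{ω₅ ≥ K}` for the triples whose
  LEVEL-4 OVERCHARGE OUTSIDE EVERY `K₀`-SET OF PRIMES is `≥ c^η`: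
  `∀ S, |S| ≤ K₀ → c^η ≤ ∏_{p ∣ abc, p ∉ S} p^⌊(v_p(abc)−1)/4⌋` (the prover choosing `η < ε/(1+ε)`,
  `K₀`, `K`, `C`).  "Diffuse" = the overcharge `log(rad₄/rad)` is spread over unboundedly many deep
  primes; the complement ("steep": some `K₀` primes capture all but `c^η` of it) is paid by crux #2
  through its landed mixed-radical normal form `MixedRadical.stub_normalForm`.
* `DiffuseRoughDeepTailABC` — the same cell intersected with the live line's ROUGH-POWERFUL cell
  (`Σ_{p>y}(v_p−1) log p ≥ θ log c`, Ridout's unconditional share, `deepRegimeABC_of_roughPowerfulTail`).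

Theorems: `deepRegimeABC_of_ustf_of_diffuse : UniformSadicTowerFour → DiffuseDeepTailABC → DeepRegimeABC`,
`deepRegimeABC_of_ustf_of_diffuseRough`, the trivial converses, hence
`deepRegimeABC_iff_diffuseRough (h₂ : UniformSadicTowerFour) : DeepRegimeABC ↔ DiffuseRoughDeepTailABC`
and the negation normal form `not_deepRegimeABC_iff`.  Reading: GIVEN the route's bet #2, the whole of #6
is abc on deep + rough-powerful + level-4-diffuse triples — the "flat-heavy very-deep" cell of the route
text, now a decl; no engine is claimed on it (census §Decomposition says why it is not filed as an item).

Also (§Strengthen S2): `TailExpShape` — the exponent-shape strengthening `c < C₀·rad^{1+g(ω₅(abc))}`,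
`g → 0` — implies the crux AND polynomial abc (`deepRegimeABC_of_tailExpShape`, `polyABC_of_tailExpShape`).
-/

noncomputable section

-- `Summit.<Summit>.<Problem>` is the mandated summit-side namespace (CONVENTIONS §2); for the
-- single-conjunct summit `ABC` the two coincide, so the duplicate `ABC.ABC` is deliberate.
set_option linter.dupNamespace false

namespace Summit.ABC.ABC.Cruxes.DeepRegimeABC.Strategist

open Literature.NumberTheory.DiophantineGeometry (IsABCTriple rad rad_def)
open Summit.ABC.ABC.Theses.IneffectiveSubspace
open Summit.ABC.ABC.Theorems.UniformSadicTowerFour.MixedRadical (stub_normalForm)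
open Summit.ABC.ABC.Theorems.UniformSadicTowerFour.QuarticRootWall (lt_rpow_mul_rpow_of_rpow_lt)
open Summit.ABC.ABC.Theorems.DeepRegimeABC
open scoped BigOperators
open Filter Topology

/-! ## Statements -/

/-- The landed NORMAL FORM of crux #2 at budget `K₀` (`MixedRadical.stub_normalForm`:
`UniformSadicTowerFour ↔ ∀ K₀, MixedNF K₀`): `c < C·M_S(abc)^(1+ε)` for every abc triple and every set `S`
of at most `K₀` primes, `M_S(N) = (∏_{p∈S} p)·∏_{p∣N, p∉S} p^⌈v_p(N)/4⌉`. -/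
def MixedNF (K₀ : ℕ) : Prop :=
  ∀ ε : ℝ, 0 < ε → ∃ C : ℝ, 0 < C ∧ ∀ S : Finset ℕ, S.card ≤ K₀ → (∀ p ∈ S, Nat.Prime p) →
    ∀ a b c : ℕ, IsABCTriple a b c →
      (c : ℝ) < C * ((((∏ p ∈ S, p) *
        ∏ p ∈ (a * b * c).primeFactors \ S, p ^ (((a * b * c).factorization p + 3) / 4) : ℕ) : ℝ)) ^
          (1 + ε)

/-- **Sub-statement D (the DIFFUSE deep tail).** For every `ε > 0` there are `η` with
`0 < η < ε/(1+ε)`, budgets `K₀, K` and `C > 0` such that every abc triple with `ω₅(abc) ≥ K` whose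
level-4 overcharge outside EVERY set of at most `K₀` primes is at least `c^η`,
`∀ S, |S| ≤ K₀ → c^η ≤ ∏_{p ∣ abc, p ∉ S} p^⌊(v_p(abc) − 1)/4⌋`, satisfies `c < C·rad(abc)^(1+ε)`. -/
def DiffuseDeepTailABC : Prop :=
  ∀ ε : ℝ, 0 < ε → ∃ η : ℝ, 0 < η ∧ η * (1 + ε) < ε ∧ ∃ K₀ : ℕ, ∃ K : ℕ, ∃ C : ℝ, 0 < C ∧
    ∀ a b c : ℕ, IsABCTriple a b c →
      K ≤ ((a * b * c).primeFactors.filter (fun p => 5 ≤ (a * b * c).factorization p)).card →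
      (∀ S : Finset ℕ, S.card ≤ K₀ →
        (c : ℝ) ^ η ≤ ((∏ p ∈ (a * b * c).primeFactors \ S,
          p ^ (((a * b * c).factorization p - 1) / 4) : ℕ) : ℝ)) →
      (c : ℝ) < C * ((rad a b c : ℕ) : ℝ) ^ (1 + ε)

/-- **Sub-statement DR (the DIFFUSE ROUGH deep tail)** — D intersected with the live line's
rough-powerful cell: for every `ε > 0` and every `0 < θ < ε/(1+ε)` there are `η ∈ (0, ε/(1+ε))`, `y`,
`K₀`, `K`, `C > 0` such that every abc triple with `ω₅ ≥ K`, rough powerful excess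
`Σ_{p > y, p ∣ abc} (v_p − 1) log p ≥ θ log c` AND level-4 overcharge `≥ c^η` outside every `K₀`-set
satisfies `c < C·rad^(1+ε)`. -/
def DiffuseRoughDeepTailABC : Prop :=
  ∀ ε : ℝ, 0 < ε → ∀ θ : ℝ, 0 < θ → θ * (1 + ε) < ε →
    ∃ η : ℝ, 0 < η ∧ η * (1 + ε) < ε ∧ ∃ y : ℕ, ∃ K₀ : ℕ, ∃ K : ℕ, ∃ C : ℝ, 0 < C ∧
    ∀ a b c : ℕ, IsABCTriple a b c →
      K ≤ ((a * b * c).primeFactors.filter (fun p => 5 ≤ (a * b * c).factorization p)).card →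
      θ * Real.log c ≤
        ∑ p ∈ (a * b * c).primeFactors.filter (fun p => ¬ p ≤ y),
          (((a * b * c).factorization p : ℝ) - 1) * Real.log p →
      (∀ S : Finset ℕ, S.card ≤ K₀ →
        (c : ℝ) ^ η ≤ ((∏ p ∈ (a * b * c).primeFactors \ S,
          p ^ (((a * b * c).factorization p - 1) / 4) : ℕ) : ℝ)) →
      (c : ℝ) < C * ((rad a b c : ℕ) : ℝ) ^ (1 + ε)

/-! ## Bookkeeping: the mixed radical at `S ∩ supp` is `rad · (overcharge outside S)` -/

/-- `M_{supp ∩ S}(abc) = rad(abc) · ∏_{p ∣ abc, p ∉ S} p^⌊(v_p − 1)/4⌋` (`⌈v/4⌉ = ⌊(v−1)/4⌋ + 1` for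
`v ≥ 1`). [folklore] -/
theorem mixed_inter_eq_rad (a b c : ℕ) (S : Finset ℕ) :
    (∏ p ∈ (a * b * c).primeFactors ∩ S, p) *
        ∏ p ∈ (a * b * c).primeFactors \ ((a * b * c).primeFactors ∩ S),
          p ^ (((a * b * c).factorization p + 3) / 4) =
      rad a b c * ∏ p ∈ (a * b * c).primeFactors \ S,
        p ^ (((a * b * c).factorization p - 1) / 4) := by
  have hsd : (a * b * c).primeFactors \ ((a * b * c).primeFactors ∩ S) =
      (a * b * c).primeFactors \ S := by
    ext p
    simp only [Finset.mem_sdiff, Finset.mem_inter]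
    tauto
  have hsplit : ∏ p ∈ (a * b * c).primeFactors \ S, p ^ (((a * b * c).factorization p + 3) / 4) =
      (∏ p ∈ (a * b * c).primeFactors \ S, p) *
        ∏ p ∈ (a * b * c).primeFactors \ S, p ^ (((a * b * c).factorization p - 1) / 4) := by
    rw [← Finset.prod_mul_distrib]
    refine Finset.prod_congr rfl fun p hp => ?_
    obtain ⟨hp', hdvd, hN0⟩ := Nat.mem_primeFactors.mp (Finset.mem_sdiff.mp hp).1
    have hv : 0 < (a * b * c).factorization p := hp'.factorization_pos_of_dvd hN0 hdvd
    have he : ((a * b * c).factorization p + 3) / 4 = ((a * b * c).factorization p - 1) / 4 + 1 := by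
      omega
    rw [he, pow_succ, mul_comm]
  rw [hsd, hsplit, ← mul_assoc, Finset.prod_inter_mul_prod_sdiff, rad_def,
    Nat.radical_eq_prod_primeFactors]

/-! ## The steep case: what crux #2 pays -/

/-- **Steep triples are paid by the normal form of crux #2.** Given `MixedNF` at every budget and
parameters `0 < η`, `η(1+ε) < ε`, there is `C₂ > 0` such that every abc triple admitting a set `S` of at
most `K₀` primes with overcharge outside `S` below `c^η` satisfies `c < C₂·rad(abc)^(1+ε)`.
Bookkeeping: apply `MixedNF K₀` at `ε₁ = (ε − η(1+ε))/(2(1+ε))` and `S ∩ supp(abc)`; then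
`M = rad·O < rad·c^η`, so `c^{1−η(1+ε₁)} < C₁ rad^{1+ε₁}` and `(1+ε₁)/(1−η(1+ε₁)) ≤ 1+ε`. [folklore] -/
theorem steep_constant (hM : ∀ K₀, MixedNF K₀) {ε η : ℝ} (hε : 0 < ε) (_hη : 0 < η)
    (hηε : η * (1 + ε) < ε) (K₀ : ℕ) :
    ∃ C₂ : ℝ, 0 < C₂ ∧ ∀ a b c : ℕ, IsABCTriple a b c → ∀ S : Finset ℕ, S.card ≤ K₀ →
      ((∏ p ∈ (a * b * c).primeFactors \ S,
          p ^ (((a * b * c).factorization p - 1) / 4) : ℕ) : ℝ) < (c : ℝ) ^ η →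
      (c : ℝ) < C₂ * ((rad a b c : ℕ) : ℝ) ^ (1 + ε) := by
  -- parameters
  have hE : (0 : ℝ) < 1 + ε := by linarith
  set g : ℝ := ε - η * (1 + ε) with hgdef
  have hg0 : 0 < g := by rw [hgdef]; linarith
  set ε₁ : ℝ := g / (2 * (1 + ε)) with hε₁def
  have hε₁ : 0 < ε₁ := by positivity
  set s : ℝ := η * (1 + ε₁) with hsdef
  have hkey : (1 + ε) * (1 - s) - (1 + ε₁) = g / 2 + g * ε₁ := by
    rw [hsdef, hε₁def, hgdef]
    field_simp
    ring
  have hprod : 1 + ε₁ < (1 + ε) * (1 - s) := by nlinarith [mul_pos hg0 hε₁]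
  have hs1 : 0 < 1 - s := by
    by_contra h
    push Not at h
    have := mul_le_mul_of_nonneg_left h hE.le
    linarith
  have hexp : (1 + ε₁) / (1 - s) ≤ 1 + ε := by
    rw [div_le_iff₀ hs1]; linarith
  obtain ⟨C₁, hC₁, hMK⟩ := hM K₀ ε₁ hε₁
  refine ⟨C₁ ^ (1 / (1 - s)), by positivity, fun a b c habc S hcard hO => ?_⟩
  -- apply the normal form at `S ∩ supp(abc)`
  have hS'card : ((a * b * c).primeFactors ∩ S).card ≤ K₀ :=
    (Finset.card_le_card Finset.inter_subset_right).trans hcard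
  have hS'prime : ∀ p ∈ (a * b * c).primeFactors ∩ S, Nat.Prime p := fun p hp =>
    Nat.prime_of_mem_primeFactors (Finset.mem_inter.mp hp).1
  have key := hMK _ hS'card hS'prime a b c habc
  rw [mixed_inter_eq_rad] at key
  -- sizes
  obtain ⟨ha, hb, hsum, -⟩ := habc
  have hc1 : (1 : ℝ) ≤ c := by exact_mod_cast (show 1 ≤ c by omega)
  have hc0 : (0 : ℝ) < c := by linarith
  have hrad1 : (1 : ℝ) ≤ ((rad a b c : ℕ) : ℝ) := by
    rw [rad_def]; exact_mod_cast Nat.pos_of_ne_zero UniqueFactorizationMonoid.radical_ne_zero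
  have hrad0 : (0 : ℝ) ≤ ((rad a b c : ℕ) : ℝ) := by linarith
  set O : ℕ := ∏ p ∈ (a * b * c).primeFactors \ S,
    p ^ (((a * b * c).factorization p - 1) / 4) with hOdef
  have hX : ((rad a b c * O : ℕ) : ℝ) ≤ ((rad a b c : ℕ) : ℝ) * (c : ℝ) ^ η := by
    push_cast
    exact mul_le_mul_of_nonneg_left hO.le hrad0
  have h1 : (c : ℝ) < C₁ * (((rad a b c : ℕ) : ℝ) ^ (1 + ε₁) * (c : ℝ) ^ s) := by
    have hmono : ((rad a b c * O : ℕ) : ℝ) ^ (1 + ε₁) ≤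
        (((rad a b c : ℕ) : ℝ) * (c : ℝ) ^ η) ^ (1 + ε₁) :=
      Real.rpow_le_rpow (by positivity) hX (by linarith)
    have hsplit : (((rad a b c : ℕ) : ℝ) * (c : ℝ) ^ η) ^ (1 + ε₁) =
        ((rad a b c : ℕ) : ℝ) ^ (1 + ε₁) * (c : ℝ) ^ s := by
      rw [Real.mul_rpow hrad0 (Real.rpow_nonneg hc0.le η), ← Real.rpow_mul hc0.le, hsdef]
    calc (c : ℝ) < C₁ * ((rad a b c * O : ℕ) : ℝ) ^ (1 + ε₁) := key
      _ ≤ C₁ * (((rad a b c : ℕ) : ℝ) * (c : ℝ) ^ η) ^ (1 + ε₁) :=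
          mul_le_mul_of_nonneg_left hmono hC₁.le
      _ = C₁ * (((rad a b c : ℕ) : ℝ) ^ (1 + ε₁) * (c : ℝ) ^ s) := by rw [hsplit]
  have h2 : (c : ℝ) ^ (1 - s) < C₁ * ((rad a b c : ℕ) : ℝ) ^ (1 + ε₁) := by
    rw [Real.rpow_sub hc0, Real.rpow_one, div_lt_iff₀ (Real.rpow_pos_of_pos hc0 _)]
    calc (c : ℝ) < C₁ * (((rad a b c : ℕ) : ℝ) ^ (1 + ε₁) * (c : ℝ) ^ s) := h1
      _ = C₁ * ((rad a b c : ℕ) : ℝ) ^ (1 + ε₁) * (c : ℝ) ^ s := by ring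
  have h3 := lt_rpow_mul_rpow_of_rpow_lt hc0.le hC₁.le hrad0 hs1 h2
  exact h3.trans_le (mul_le_mul_of_nonneg_left
    (Real.rpow_le_rpow_of_exponent_le hrad1 hexp) (by positivity))

/-! ## Composition: crux #2 + DIFFUSE ⟹ crux #6 -/

/-- `(∀ K₀, MixedNF K₀) → DiffuseDeepTailABC → DeepRegimeABC`: case split steep / diffuse at the budget
`K₀(ε)` and the share `η(ε)` supplied by D; max of two constants. [folklore] -/
theorem deepRegimeABC_of_mixedNF_of_diffuse (hM : ∀ K₀, MixedNF K₀) (hD : DiffuseDeepTailABC) :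
    DeepRegimeABC := by
  intro ε hε
  obtain ⟨η, hη, hηε, K₀, K, C, hC, hDK⟩ := hD ε hε
  obtain ⟨C₂, hC₂, hsteep⟩ := steep_constant hM hε hη hηε K₀
  refine ⟨K, max C C₂, lt_max_of_lt_left hC, fun a b c habc hK => ?_⟩
  have hrad0 : (0 : ℝ) ≤ ((rad a b c : ℕ) : ℝ) ^ (1 + ε) := by positivity
  by_cases hdiff : ∀ S : Finset ℕ, S.card ≤ K₀ →
      (c : ℝ) ^ η ≤ ((∏ p ∈ (a * b * c).primeFactors \ S,
        p ^ (((a * b * c).factorization p - 1) / 4) : ℕ) : ℝ)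
  · exact (hDK a b c habc hK hdiff).trans_le
      (mul_le_mul_of_nonneg_right (le_max_left _ _) hrad0)
  · push Not at hdiff
    obtain ⟨S, hScard, hO⟩ := hdiff
    exact (hsteep a b c habc S hScard hO).trans_le
      (mul_le_mul_of_nonneg_right (le_max_right _ _) hrad0)

/-- **The typed split D2**: `UniformSadicTowerFour → DiffuseDeepTailABC → DeepRegimeABC` (crux #2 and
the diffuse deep tail give crux #6), through the landed normal form of #2. [folklore] -/
theorem deepRegimeABC_of_ustf_of_diffuse (h₂ : UniformSadicTowerFour) (hD : DiffuseDeepTailABC) :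
    DeepRegimeABC :=
  deepRegimeABC_of_mixedNF_of_diffuse (fun K₀ => (stub_normalForm.mp h₂) K₀) hD

/-- Losslessness: the crux implies D (take `η = ε/(2(1+ε))`, `K₀ = 0`, ignore diffuseness). [folklore] -/
theorem diffuse_of_deepRegimeABC (h : DeepRegimeABC) : DiffuseDeepTailABC := by
  intro ε hε
  obtain ⟨K, C, hC, hK⟩ := h ε hε
  refine ⟨ε / (2 * (1 + ε)), by positivity, ?_, 0, K, C, hC,
    fun a b c habc hKle _ => hK a b c habc hKle⟩
  have : ε / (2 * (1 + ε)) * (1 + ε) = ε / 2 := by field_simp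
  rw [this]; linarith

/-! ## Composition with the live line's Ridout share: crux #2 + DIFFUSE-ROUGH ⟹ crux #6 -/

/-- `(∀ K₀, MixedNF K₀) → DiffuseRoughDeepTailABC → RoughPowerfulTailABC` (the live line's open stub
`stub_roughPowerfulTail`, written out): inside the rough-powerful cell, steep triples are paid by #2,
diffuse ones by DR. [folklore] -/
theorem roughPowerfulTail_of_mixedNF_of_diffuseRough (hM : ∀ K₀, MixedNF K₀)
    (hD : DiffuseRoughDeepTailABC) :
    ∀ ε : ℝ, 0 < ε → ∀ θ : ℝ, 0 < θ → θ * (1 + ε) < ε → ∃ y : ℕ, ∃ K : ℕ, ∃ C : ℝ, 0 < C ∧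
      ∀ a b c : ℕ, IsABCTriple a b c →
        K ≤ ((a * b * c).primeFactors.filter (fun p => 5 ≤ (a * b * c).factorization p)).card →
        θ * Real.log c ≤
          ∑ p ∈ (a * b * c).primeFactors.filter (fun p => ¬ p ≤ y),
            (((a * b * c).factorization p : ℝ) - 1) * Real.log p →
        (c : ℝ) < C * ((rad a b c : ℕ) : ℝ) ^ (1 + ε) := by
  intro ε hε θ hθ hθε
  obtain ⟨η, hη, hηε, y, K₀, K, C, hC, hDK⟩ := hD ε hε θ hθ hθε
  obtain ⟨C₂, hC₂, hsteep⟩ := steep_constant hM hε hη hηε K₀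
  refine ⟨y, K, max C C₂, lt_max_of_lt_left hC, fun a b c habc hK hrough => ?_⟩
  have hrad0 : (0 : ℝ) ≤ ((rad a b c : ℕ) : ℝ) ^ (1 + ε) := by positivity
  by_cases hdiff : ∀ S : Finset ℕ, S.card ≤ K₀ →
      (c : ℝ) ^ η ≤ ((∏ p ∈ (a * b * c).primeFactors \ S,
        p ^ (((a * b * c).factorization p - 1) / 4) : ℕ) : ℝ)
  · exact (hDK a b c habc hK hrough hdiff).trans_le
      (mul_le_mul_of_nonneg_right (le_max_left _ _) hrad0)
  · push Not at hdiff
    obtain ⟨S, hScard, hO⟩ := hdiff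
    exact (hsteep a b c habc S hScard hO).trans_le
      (mul_le_mul_of_nonneg_right (le_max_right _ _) hrad0)

/-- **The sharpest typed residue**: `UniformSadicTowerFour → DiffuseRoughDeepTailABC → DeepRegimeABC`
(crux #2, the landed Ridout core bound inside `deepRegimeABC_of_roughPowerfulTail`, and DR give #6).
[folklore] -/
theorem deepRegimeABC_of_ustf_of_diffuseRough (h₂ : UniformSadicTowerFour)
    (hD : DiffuseRoughDeepTailABC) : DeepRegimeABC :=
  deepRegimeABC_of_roughPowerfulTail
    (roughPowerfulTail_of_mixedNF_of_diffuseRough (fun K₀ => (stub_normalForm.mp h₂) K₀) hD)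

/-- Losslessness: the crux implies DR. [folklore] -/
theorem diffuseRough_of_deepRegimeABC (h : DeepRegimeABC) : DiffuseRoughDeepTailABC := by
  intro ε hε θ _ _
  obtain ⟨K, C, hC, hK⟩ := h ε hε
  refine ⟨ε / (2 * (1 + ε)), by positivity, ?_, 0, 0, K, C, hC,
    fun a b c habc hKle _ _ => hK a b c habc hKle⟩
  have : ε / (2 * (1 + ε)) * (1 + ε) = ε / 2 := by field_simp
  rw [this]; linarith

/-- **GIVEN crux #2, crux #6 IS the diffuse-rough deep tail** (both directions). [folklore] -/
theorem deepRegimeABC_iff_diffuseRough (h₂ : UniformSadicTowerFour) :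
    DeepRegimeABC ↔ DiffuseRoughDeepTailABC :=
  ⟨diffuseRough_of_deepRegimeABC, deepRegimeABC_of_ustf_of_diffuseRough h₂⟩

/-- GIVEN crux #2, crux #6 is also the plain diffuse deep tail. [folklore] -/
theorem deepRegimeABC_iff_diffuse (h₂ : UniformSadicTowerFour) :
    DeepRegimeABC ↔ DiffuseDeepTailABC :=
  ⟨diffuse_of_deepRegimeABC, deepRegimeABC_of_ustf_of_diffuse h₂⟩

/-- **Negation normal form (census §Negation N0).** Given crux #2, a counterexample to crux #6 is
exactly a counterexample to DR: an `ε > 0` and a `θ < ε/(1+ε)` such that for EVERY share `η < ε/(1+ε)`,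
cut-off `y`, budgets `K₀, K` and constant `C` some abc triple is deep (`ω₅ ≥ K`), rough-powerful at
`(y, θ)`, level-4-diffuse at `(K₀, η)` and has `c ≥ C·rad^(1+ε)`. [folklore] -/
theorem not_deepRegimeABC_iff (h₂ : UniformSadicTowerFour) :
    ¬ DeepRegimeABC ↔ ¬ DiffuseRoughDeepTailABC :=
  (deepRegimeABC_iff_diffuseRough h₂).not

/-- Unconditionally: `ABC → DiffuseRoughDeepTailABC` and `ABC → DiffuseDeepTailABC` (through
`deepRegimeABC_of_abc`), so neither sub-statement is stronger than the summit. [folklore] -/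
theorem diffuseRough_of_abc (h : _root_.ABC) : DiffuseRoughDeepTailABC :=
  diffuseRough_of_deepRegimeABC (deepRegimeABC_of_abc h)

theorem diffuse_of_abc (h : _root_.ABC) : DiffuseDeepTailABC :=
  diffuse_of_deepRegimeABC (deepRegimeABC_of_abc h)

/-! ## §Strengthen S2: the exponent-shape strengthening implies the crux AND polynomial abc -/

/-- **TailExpShape** (`BarrierNotes-r2-k4` E1(b), "TailExp(g)"): ONE constant and an exponent loss
that decays with the 5-depth count: `c < C₀ · rad(abc)^(1 + g(ω₅(abc)))` with `g → 0`. -/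
def TailExpShape : Prop :=
  ∃ C₀ : ℝ, 0 < C₀ ∧ ∃ g : ℕ → ℝ, (∀ n, 0 ≤ g n) ∧ Tendsto g atTop (𝓝 0) ∧
    ∀ a b c : ℕ, IsABCTriple a b c →
      (c : ℝ) < C₀ * ((rad a b c : ℕ) : ℝ) ^
        (1 + g ((a * b * c).primeFactors.filter (fun p => 5 ≤ (a * b * c).factorization p)).card)

/-- `TailExpShape → DeepRegimeABC` (`K(ε)` := where `g` drops below `ε`; `rad ≥ 1`). [folklore] -/
theorem deepRegimeABC_of_tailExpShape (h : TailExpShape) : DeepRegimeABC := by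
  obtain ⟨C₀, hC₀, g, hg0, hg, hall⟩ := h
  intro ε hε
  have hev : ∀ᶠ n in atTop, g n < ε := hg.eventually (gt_mem_nhds hε)
  obtain ⟨K, hK⟩ := Filter.eventually_atTop.mp hev
  refine ⟨K, C₀, hC₀, fun a b c habc hKle => ?_⟩
  have hrad1 : (1 : ℝ) ≤ ((rad a b c : ℕ) : ℝ) := by
    rw [rad_def]; exact_mod_cast Nat.pos_of_ne_zero UniqueFactorizationMonoid.radical_ne_zero
  refine (hall a b c habc).trans_le (mul_le_mul_of_nonneg_left ?_ hC₀.le)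
  exact Real.rpow_le_rpow_of_exponent_le hrad1 (by linarith [hK _ hKle])

/-- `TailExpShape →` POLYNOMIAL abc `c < C₀·rad^κ` for all abc triples (`κ := 1 + sup g`): the
exponent-shape strengthening of the crux is at least a polynomial-abc engine (Stewart–Yu scale
breakthrough), cf. `WindowGivesPolynomialAbc`'s conclusion. [folklore] -/
theorem polyABC_of_tailExpShape (h : TailExpShape) :
    ∃ κ C : ℝ, 0 < C ∧ ∀ a b c : ℕ, IsABCTriple a b c →
      (c : ℝ) < C * ((rad a b c : ℕ) : ℝ) ^ κ := by
  obtain ⟨C₀, hC₀, g, hg0, hg, hall⟩ := h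
  obtain ⟨B, hB⟩ := hg.bddAbove_range
  refine ⟨1 + B, C₀, hC₀, fun a b c habc => ?_⟩
  have hrad1 : (1 : ℝ) ≤ ((rad a b c : ℕ) : ℝ) := by
    rw [rad_def]; exact_mod_cast Nat.pos_of_ne_zero UniqueFactorizationMonoid.radical_ne_zero
  refine (hall a b c habc).trans_le (mul_le_mul_of_nonneg_left ?_ hC₀.le)
  refine Real.rpow_le_rpow_of_exponent_le hrad1 ?_
  have hgB := hB (Set.mem_range_self (f := g)
    ((a * b * c).primeFactors.filter (fun p => 5 ≤ (a * b * c).factorization p)).card)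
  linarith

end Summit.ABC.ABC.Cruxes.DeepRegimeABC.Strategist

end
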